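import Literature.NumberTheory.LFunctions.ZetaZeroDensityVinogradovKorobovEdge
import HarnessLib

/-!
# RH-FREE — Bellotti 2026, Theorem 1.3: its exponential-sum hypothesis is a theorem of the tree (Ivić, Thm 6.2), hence Theorem 1.3 ⇒ Theorem 1.2 with no extra input («nothing here bears on the truth of RH»)

Topic `Literature/NumberTheory/LFunctions` (RH literature-typing tranche 1, L4 "explicit zero
statistics", gen 10). Label **RH-FREE**. THEOREMS only (no definitions, no named facts). Nothing
here bears on the truth of RH.

`ZetaZeroDensityVinogradovKorobovEdge.lean` types Bellotti's Theorem 1.3 (Bull. Lond. Math. Soc. 58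
(2026), no. 7) with its hypothesis on the exponential sums (1.2),
`S(N,t) = max_{N<R≤2N}|Σ_{N≤n≤R} n^{−it}| ≪ N^{1−1/(Dλ²)}` (`1 ≤ N ≤ t`, `λ = log t/log N`), as the
predicate `Bellotti2026.ExpSumHyp D`. The tree already PROVES Vinogradov's estimate in Ford's shape
for the shifted sums, `ExpSumBound C D : ‖Σ_{N<n≤R}(n+u)^{−it}‖ ≤ C N^{1 − (log N)²/(D(log t)²)}`
(`1 ≤ N < R ≤ 2N`, `N ≤ t`, `0 < u ≤ 1`; `RichertBoundsFromExpSum.lean`), with an inexplicit instance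
`VKZeta.expSumBound_ivic : ∃ C D, 0 ≤ C ∧ 0 < D ∧ ExpSumBound C D` (Ivić 1985, Theorem 6.2 — the
tree's kernel proof from Vinogradov's mean value theorem). Here the bookkeeping between the two shapes
is done:

* `Bellotti2026.expSumHyp_of_expSumBound` — `ExpSumBound C D`, `C ≥ 0`, `D ≥ 1` ⇒ `ExpSumHyp (8D)`
  (constant `C + 4`): write `Σ_{n=N}^{R} n^{−it} = Σ_{N−2<m≤R−1}(m+1)^{−it}` (shift `u = 1`), the
  block `R ≤ 2N−3` being a dyadic block for `N − 2`, the at most three terms `2N−2 ≤ n ≤ R` and the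
  ranges `N ≤ 3` bounded trivially; the loss `log(N−2) ≥ ½ log N` (`N ≥ 4`) is the factor `8` in `D`;
* `Bellotti2026.exists_expSumHyp : ∃ D > 0, ExpSumHyp D` — UNCONDITIONAL, from `VKZeta.expSumBound_ivic`;
* `Bellotti2026_thm13.thm12_unconditional : Bellotti2026_thm13 → Bellotti2026_thm12` — Theorem 1.3
  implies Theorem 1.2 outright (the source: "Theorem 1.2 can be made more precise [as Theorem 1.3]").

## References

* C. Bellotti, Bull. Lond. Math. Soc. 58 (2026), no. 7 = arXiv:2508.02041v1, Thms 1.2–1.3, eq. (1.2).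
  [Bellotti2026ZeroDensity]
* A. Ivić, *The Riemann Zeta-Function*, Wiley 1985, Theorem 6.2. [Ivic1985]
* K. Ford, Proc. London Math. Soc. 85 (2002) 565–633, Theorem 2 (the shape `ExpSumBound`). [Ford2002]
-/

noncomputable section

open Complex Real Finset

namespace Literature.NumberTheory.LFunctions

namespace Bellotti2026

/-- `‖n^{−it}‖ = 1` for a positive integer `n`. [folklore] -/
private theorem norm_natCast_cpow_neg_mul_I {n : ℕ} (hn : 0 < n) (t : ℝ) :
    ‖(n : ℂ) ^ (-(t * I))‖ = 1 := by
  rw [norm_natCast_cpow_of_pos hn]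
  simp

/-- A sum of unimodular terms `n^{−it}` over positive integers has norm at most the number of terms.
[folklore] -/
private theorem norm_sum_cpow_le_card (S : Finset ℕ) (hS : ∀ n ∈ S, 0 < n) (t : ℝ) :
    ‖∑ n ∈ S, (n : ℂ) ^ (-(t * I))‖ ≤ (S.card : ℝ) := by
  calc ‖∑ n ∈ S, (n : ℂ) ^ (-(t * I))‖ ≤ ∑ n ∈ S, ‖(n : ℂ) ^ (-(t * I))‖ := norm_sum_le _ _
    _ = ∑ _n ∈ S, (1 : ℝ) := Finset.sum_congr rfl fun n hn ↦ norm_natCast_cpow_neg_mul_I (hS n hn) t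
    _ = S.card := by simp

/-- The shifted dyadic sum of `ExpSumBound` at `u = 1` is an unshifted sum:
`Σ_{N'<m≤R'} (m+1)^{−it} = Σ_{N'+1<n≤R'+1} n^{−it}`. [folklore] -/
private theorem sum_shift (N' R' : ℕ) (t : ℝ) :
    ∑ m ∈ Ioc N' R', ((m : ℂ) + ((1 : ℝ) : ℂ)) ^ (-(t * I)) =
      ∑ n ∈ Ioc (N' + 1) (R' + 1), (n : ℂ) ^ (-(t * I)) := by
  rw [← Finset.image_add_right_Ioc N' R' 1, Finset.sum_image (by intro a _ b _ h; simpa using h)]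
  refine Finset.sum_congr rfl fun m _ ↦ ?_
  push_cast; ring_nf

/-- The exponent comparison behind the factor `8`: for `4 ≤ N ≤ t` and `D ≥ 1`,
`(N−2)^{1 − (log(N−2))²/(D log²t)} ≤ N^{1 − (log N)²/(8D log²t)}` (`log(N−2) ≥ ½ log N` as
`(N−2)² ≥ N`). [folklore] -/
private theorem rpow_shift_le {N : ℕ} {t D : ℝ} (hN : 4 ≤ N) (hNt : (N : ℝ) ≤ t) (hD : 1 ≤ D) :
    ((N : ℝ) - 2) ^ (1 - Real.log ((N : ℝ) - 2) ^ 2 / (D * Real.log t ^ 2)) ≤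
      (N : ℝ) ^ (1 - Real.log N ^ 2 / (8 * D * Real.log t ^ 2)) := by
  have hN4 : (4 : ℝ) ≤ N := by exact_mod_cast hN
  have hN2 : (2 : ℝ) ≤ (N : ℝ) - 2 := by linarith
  have hlogN0 : 0 ≤ Real.log N := Real.log_nonneg (by linarith)
  have hlog2 : Real.log N / 2 ≤ Real.log ((N : ℝ) - 2) := by
    -- `(N-2)² ≥ N`
    have hsq : (N : ℝ) ≤ ((N : ℝ) - 2) ^ 2 := by nlinarith
    have h1 : Real.log N ≤ Real.log (((N : ℝ) - 2) ^ 2) := Real.log_le_log (by linarith) hsq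
    rw [Real.log_pow] at h1
    push_cast at h1
    linarith
  have hlogN2_0 : 0 ≤ Real.log ((N : ℝ) - 2) := Real.log_nonneg (by linarith)
  -- the two exponent reductions
  set L := Real.log t with hL
  have hLN : Real.log N ≤ L := Real.log_le_log (by linarith) hNt
  have hL0 : 0 ≤ L := hlogN0.trans hLN
  have hb : Real.log N ^ 2 / (8 * D * L ^ 2) ≤ Real.log ((N : ℝ) - 2) ^ 2 / (D * L ^ 2) := by
    rcases eq_or_lt_of_le hL0 with hL00 | hLpos
    · simp [← hL00]
    · have hD0 : 0 < D := by linarith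
      rw [div_le_div_iff₀ (by positivity) (by positivity)]
      have h4 : Real.log N ^ 2 ≤ 4 * Real.log ((N : ℝ) - 2) ^ 2 := by nlinarith
      have : Real.log N ^ 2 * (D * L ^ 2) ≤ 4 * Real.log ((N : ℝ) - 2) ^ 2 * (D * L ^ 2) :=
        mul_le_mul_of_nonneg_right h4 (by positivity)
      nlinarith [this, sq_nonneg L, mul_nonneg hD0.le (sq_nonneg L),
        mul_nonneg (sq_nonneg (Real.log ((N : ℝ) - 2))) (mul_nonneg hD0.le (sq_nonneg L))]
  have ha1 : Real.log N ^ 2 / (8 * D * L ^ 2) ≤ 1 := by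
    rcases eq_or_lt_of_le hL0 with hL00 | hLpos
    · simp [← hL00]
    · rw [div_le_one (by positivity)]
      have : Real.log N ^ 2 ≤ L ^ 2 := pow_le_pow_left₀ hlogN0 hLN 2
      nlinarith [sq_nonneg L]
  calc ((N : ℝ) - 2) ^ (1 - Real.log ((N : ℝ) - 2) ^ 2 / (D * L ^ 2))
      ≤ ((N : ℝ) - 2) ^ (1 - Real.log N ^ 2 / (8 * D * L ^ 2)) :=
        Real.rpow_le_rpow_of_exponent_le (by linarith) (by linarith)
    _ ≤ (N : ℝ) ^ (1 - Real.log N ^ 2 / (8 * D * L ^ 2)) :=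
        Real.rpow_le_rpow (by linarith) (by linarith) (by linarith)

/-- **Bellotti's hypothesis (1.2) from the tree's `ExpSumBound`**: if
`‖Σ_{N<n≤R}(n+u)^{−it}‖ ≤ C N^{1−(log N)²/(D log²t)}` for `1 ≤ N < R ≤ 2N`, `N ≤ t`, `0 < u ≤ 1`
(`C ≥ 0`, `D ≥ 1`), then `‖Σ_{n=N}^{R} n^{−it}‖ ≤ (C+4) N^{1−(log N)²/(8D log²t)}` in the same ranges,
i.e. `ExpSumHyp (8D)`. [cite: Bellotti2026ZeroDensity, §1 eq. (1.2) and Thm 1.3] [cite: Ford2002, Theorem 2] -/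
theorem expSumHyp_of_expSumBound {C D : ℝ} (hC : 0 ≤ C) (hD : 1 ≤ D) (h : ExpSumBound C D) :
    ExpSumHyp (8 * D) := by
  refine ⟨C + 4, fun N R t hN hNR hR2 hNt ↦ ?_⟩
  have hN1 : (1 : ℝ) ≤ N := by exact_mod_cast hN
  set e : ℝ := 1 - Real.log N ^ 2 / (8 * D * Real.log t ^ 2) with he
  -- the main term is at least `1`
  have hlogN0 : 0 ≤ Real.log N := Real.log_nonneg hN1
  have hL0 : 0 ≤ Real.log t := hlogN0.trans (Real.log_le_log (by linarith) hNt)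
  have he0 : 0 ≤ e := by
    rw [he]
    rcases eq_or_lt_of_le hL0 with hL00 | hLpos
    · simp [← hL00]
    · have : Real.log N ^ 2 / (8 * D * Real.log t ^ 2) ≤ 1 := by
        rw [div_le_one (by positivity)]
        have : Real.log N ^ 2 ≤ Real.log t ^ 2 :=
          pow_le_pow_left₀ hlogN0 (Real.log_le_log (by linarith) hNt) 2
        nlinarith [sq_nonneg (Real.log t)]
      linarith
  have hP1 : 1 ≤ (N : ℝ) ^ e := Real.one_le_rpow hN1 he0
  have hP0 : 0 ≤ (N : ℝ) ^ e := by linarith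
  have e8 : 8 * D * Real.log t ^ 2 = (8 * D) * Real.log t ^ 2 := by ring
  -- positivity of the summation indices
  have hpos : ∀ n ∈ Icc N R, 0 < n := fun n hn ↦ lt_of_lt_of_le hN (Finset.mem_Icc.1 hn).1
  rcases lt_or_ge N 4 with hsmall | hbig
  · -- `N ≤ 3`: at most `N + 1 ≤ 4` unimodular terms
    have hcard : ((Icc N R).card : ℝ) ≤ 4 := by
      rw [Nat.card_Icc]
      have : R + 1 - N ≤ 4 := by omega
      exact_mod_cast this
    calc ‖∑ n ∈ Icc N R, (n : ℂ) ^ (-(t * I))‖ ≤ (Icc N R).card := norm_sum_cpow_le_card _ hpos t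
      _ ≤ 4 * 1 := by linarith
      _ ≤ (C + 4) * (N : ℝ) ^ e := by nlinarith
      _ = _ := by rw [he, e8]
  · -- `N ≥ 4`: a dyadic block for `N' = N − 2` plus at most three terms
    set R₁ : ℕ := min R (2 * N - 3) with hR₁
    have hNR₁ : N < R₁ := by rw [hR₁]; exact lt_min hNR (by omega)
    have hR₁R : R₁ ≤ R := min_le_left _ _
    have hR₁2 : R₁ ≤ 2 * N - 3 := min_le_right _ _
    -- split `Icc N R = Ioc (N-1) R = Ioc (N-1) R₁ ∪ Ioc R₁ R`
    have hIcc : Icc N R = Ioc (N - 1) R := by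
      rw [← Finset.Icc_add_one_left_eq_Ioc]; congr 1; omega
    have hsplit := Finset.sum_Ioc_consecutive (fun n : ℕ ↦ (n : ℂ) ^ (-(t * I)))
      (show N - 1 ≤ R₁ by omega) hR₁R
    -- the dyadic block via `ExpSumBound` at `N' = N - 2`, `R' = R₁ - 1`, `u = 1`
    have hN' : 1 ≤ N - 2 := by omega
    have hN't : ((N - 2 : ℕ) : ℝ) ≤ t := le_trans (by exact_mod_cast (Nat.sub_le N 2)) hNt
    have hlt : N - 2 < R₁ - 1 := by omega
    have hle : R₁ - 1 ≤ 2 * (N - 2) := by omega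
    have hblock := h (N - 2) (R₁ - 1) t 1 hN' hN't one_pos le_rfl hlt hle
    rw [sum_shift, show N - 2 + 1 = N - 1 by omega, show R₁ - 1 + 1 = R₁ by omega] at hblock
    have hcast : ((N - 2 : ℕ) : ℝ) = (N : ℝ) - 2 := by
      rw [Nat.cast_sub (by omega)]; norm_num
    rw [hcast] at hblock
    have hmain : ‖∑ n ∈ Ioc (N - 1) R₁, (n : ℂ) ^ (-(t * I))‖ ≤ C * (N : ℝ) ^ e := by
      refine hblock.trans (mul_le_mul_of_nonneg_left ?_ hC)
      rw [he]
      exact rpow_shift_le hbig hNt hD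
    -- the tail: at most three unimodular terms
    have htail : ‖∑ n ∈ Ioc R₁ R, (n : ℂ) ^ (-(t * I))‖ ≤ 3 := by
      have hpos' : ∀ n ∈ Ioc R₁ R, 0 < n := fun n hn ↦ by
        have := (Finset.mem_Ioc.1 hn).1; omega
      refine (norm_sum_cpow_le_card _ hpos' t).trans ?_
      rw [Nat.card_Ioc]
      have : R - R₁ ≤ 3 := by omega
      exact_mod_cast this
    rw [hIcc, ← hsplit]
    calc ‖∑ n ∈ Ioc (N - 1) R₁, (n : ℂ) ^ (-(t * I)) + ∑ n ∈ Ioc R₁ R, (n : ℂ) ^ (-(t * I))‖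
        ≤ C * (N : ℝ) ^ e + 3 := (norm_add_le _ _).trans (add_le_add hmain htail)
      _ ≤ (C + 4) * (N : ℝ) ^ e := by nlinarith
      _ = _ := by rw [he, e8]

/-- Raising `D` weakens `ExpSumBound`: `ExpSumBound C D → ExpSumBound C D'` for `0 < D ≤ D'`
(`N ≥ 1`). [cite: Ford2002, Theorem 2] -/
theorem expSumBound_mono_D {C D D' : ℝ} (hD : 0 < D) (hDD' : D ≤ D') (h : ExpSumBound C D)
    (hC : 0 ≤ C) : ExpSumBound C D' := by
  intro N R t u hN hNt hu hu1 hNR hR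
  refine (h N R t u hN hNt hu hu1 hNR hR).trans (mul_le_mul_of_nonneg_left ?_ hC)
  have hN1 : (1 : ℝ) ≤ N := by exact_mod_cast hN
  refine Real.rpow_le_rpow_of_exponent_le hN1 ?_
  have h0 : 0 ≤ Real.log N ^ 2 := sq_nonneg _
  have hL : 0 ≤ Real.log t ^ 2 := sq_nonneg _
  rcases eq_or_lt_of_le hL with hL0 | hLpos
  · simp [← hL0]
  · have : Real.log N ^ 2 / (D' * Real.log t ^ 2) ≤ Real.log N ^ 2 / (D * Real.log t ^ 2) :=
      div_le_div_of_nonneg_left h0 (by positivity) (mul_le_mul_of_nonneg_right hDD' hL)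
    linarith

/-- **Unconditionally, `∃ D > 0, ExpSumHyp D`** — Bellotti's hypothesis (1.2) of Theorem 1.3 holds
for SOME `D`, by the tree's kernel theorem `VKZeta.expSumBound_ivic` (Ivić 1985, Thm 6.2, from
Vinogradov's mean value theorem) and `expSumHyp_of_expSumBound`.
[cite: Bellotti2026ZeroDensity, Thm 1.3] [cite: Ivic1985, Theorem 6.2] -/
theorem exists_expSumHyp : ∃ D : ℝ, 0 < D ∧ ExpSumHyp D := by
  obtain ⟨C, D, hC, hD, h⟩ := VKZeta.expSumBound_ivic
  have h' : ExpSumBound C (max D 1) := expSumBound_mono_D hD (le_max_left _ _) h hC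
  exact ⟨8 * max D 1, by positivity, expSumHyp_of_expSumBound hC (le_max_right _ _) h'⟩

end Bellotti2026

/-- **Theorem 1.3 implies Theorem 1.2 with no further input** (the exponential-sum hypothesis is
supplied by the tree, `Bellotti2026.exists_expSumHyp`). [cite: Bellotti2026ZeroDensity, Thms 1.2–1.3] -/
theorem Bellotti2026_thm13.thm12_unconditional (h13 : Bellotti2026_thm13) : Bellotti2026_thm12 := by
  obtain ⟨D, hD, hS⟩ := Bellotti2026.exists_expSumHyp
  exact h13.thm12 hD hS

end Literature.NumberTheory.LFunctions

end
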